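import Summits.CriticalPhenomena.PercolationContinuityZ3.Theorems.PercNearOneGluingNoHeavyLowerTailKnQuestion8CoefficientwisePendant
import HarnessLib

/-!
# One-sided domination: given the red cluster of an avoided set, the red cluster of `x` is dominated by the blue cluster of `x`
# (the single-function companion of the off-cluster theorem), and coefficientwise van den Berg–Häggström–Kahn Theorem 1.4 for a pendant `z`

Support file (`--supports stmt-CriticalPhenomena-4575`, closed), prover `prim-lf-2` (gen 29).  No definitions, no named facts, no sorries; standard axioms.
Memo `prim-lf-2/CW-VDBHK-gen29.md` (§1, 'OSD').

Setting: a finite multigraph `ends : ι → Sym2 V`, a colouring `s ⊆ ι` (red edges) with complement `sᶜ` (blue), `C_w(s) = openCluster (ends '' s) w`.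
prim-lf-2 gen 29 found by exact census that the whole of van den Berg–Häggström–Kahn's §1 (Theorems 1.1–1.5 of
[cite: VandenbergHaggstromKahn2005, §1 Thms 1.1–1.5 pp. 3–5]) appears to be *coefficientwise* positive: e.g. their Theorem 1.4 ('given `x ↮ z` the clusters
of `x` and `z` are negatively correlated') in the two-colouring form
  `Σ_{s : z ∉ C_x(s), z ∉ C_x(sᶜ)} (f(C_x s) − f(C_x sᶜ))·(g(C_z s) − g(C_z sᶜ)) ≤ 0`   (CW-NEG; 0 negatives on all graphs with ≤ 6 vertices and beyond).
This file proves the tool behind all pendant cases (the pendant case of CW-NEG itself is the companion file `…CoefficientwiseNegPendant`):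
* `Coefficientwise.cell_sum_le_flip` — on a cell `{t | t ∩ B = π}` of the cube, if `F t ≤ F ((B \ π) ∪ (t \ B))` pointwise then `Σ_{cell} F t ≤ Σ_{cell} F tᶜ`.
* `Coefficientwise.offCluster_domination` (**OSD**) — for a vertex set `A`, monotone `f` and ANY nonnegative weight `ψ` of the red cluster `R_A(s)` of `A`:
  `Σ_{s : A ∩ C_x(s) = ∅} ψ(R_A(s)) · (f(C_x s) − f(C_x sᶜ)) ≤ 0` — conditionally on the red cluster of the avoided set, the red cluster of `x` (which lives in the
  free edges off `R_A`) is stochastically dominated by the blue cluster of `x` (which gets the blue boundary of `R_A` for free).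
[cite: KozmaNitzan2024, Questions 8–9 (§5.5 p. 36) (context: the Question-8 pocket covariance programme of which this is the k = 2 rung)]
-/

namespace Summit.CriticalPhenomena.PercolationContinuityZ3.Theorems

open Finset Literature.Probability.Percolation

namespace Coefficientwise

variable {ι V : Type*}

section cells

variable [Fintype ι] [DecidableEq ι]

/-- **One-function cell lemma.**  On the cell `{t | t ∩ B = π}` (`π ⊆ B`), if `F t ≤ F ((B \ π) ∪ (t \ B))` for every `t` in the cell (the configuration with
the frozen pattern reversed and the free part kept dominates), then `Σ_{cell} F t ≤ Σ_{cell} F tᶜ`: reindex the right-hand side by the flip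
`t ↦ π ∪ (tᶜ \ B)` of the free coordinates, under which `tᶜ ↦ (B \ π) ∪ (t \ B)`.  (The single-function half of `twoColouring_cell_nonneg_of_le`.)
[cite: KozmaNitzan2024, §5.5 (context only)] -/
theorem cell_sum_le_flip (B π : Finset ι) (hπ : π ⊆ B) (F : Finset ι → ℝ)
    (hFle : ∀ t : Finset ι, t ∩ B = π → F t ≤ F ((B \ π) ∪ (t \ B))) :
    ∑ t ∈ univ.filter (fun t : Finset ι => t ∩ B = π), F t ≤ ∑ t ∈ univ.filter (fun t : Finset ι => t ∩ B = π), F tᶜ := by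
  set cell := univ.filter (fun t : Finset ι => t ∩ B = π) with hcell
  have mem_cell : ∀ t : Finset ι, t ∈ cell ↔ t ∩ B = π := fun t => by simp [hcell]
  set τ : Finset ι → Finset ι := fun t => π ∪ (tᶜ \ B) with hτ
  have facts : ∀ t : Finset ι, t ∩ B = π → ∀ i, (i ∈ π ↔ i ∈ t ∧ i ∈ B) := fun t ht i => by
    rw [← ht]; exact Finset.mem_inter
  have memτ : ∀ t i, i ∈ τ t ↔ i ∈ π ∨ (i ∉ t ∧ i ∉ B) := fun t i => by
    simp only [hτ, Finset.mem_union, Finset.mem_sdiff, Finset.mem_compl]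
  have hτcell : ∀ t, t ∩ B = π → τ t ∩ B = π := by
    intro t ht
    ext i
    simp only [Finset.mem_inter, memτ]
    have h1 := facts t ht i
    have h2 : i ∈ π → i ∈ B := fun h => hπ h
    tauto
  have hττ : ∀ t, t ∩ B = π → τ (τ t) = t := by
    intro t ht
    ext i
    rw [memτ, memτ]
    have h1 := facts t ht i
    have h2 : i ∈ π → i ∈ B := fun h => hπ h
    tauto
  have hflip : ∀ t, t ∩ B = π → tᶜ = (B \ π) ∪ (τ t \ B) := by
    intro t ht
    ext i
    simp only [Finset.mem_compl, Finset.mem_union, Finset.mem_sdiff, memτ]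
    have h1 := facts t ht i
    have h2 : i ∈ π → i ∈ B := fun h => hπ h
    tauto
  have reindex : ∑ t ∈ cell, F tᶜ = ∑ t ∈ cell, F ((B \ π) ∪ (t \ B)) := by
    refine Finset.sum_bij' (fun t _ => τ t) (fun t _ => τ t) ?_ ?_ ?_ ?_ ?_
    · intro t ht; exact (mem_cell _).mpr (hτcell t ((mem_cell t).mp ht))
    · intro t ht; exact (mem_cell _).mpr (hτcell t ((mem_cell t).mp ht))
    · intro t ht; exact hττ t ((mem_cell t).mp ht)
    · intro t ht; exact hττ t ((mem_cell t).mp ht)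
    · intro t ht; rw [hflip t ((mem_cell t).mp ht)]
  rw [reindex]
  exact Finset.sum_le_sum fun t ht => hFle t ((mem_cell t).mp ht)

end cells

variable [Fintype ι] [DecidableEq ι]

open Classical in
/-- **One-sided domination (OSD).**  For a finite multigraph, a vertex `x`, a vertex set `A`, a monotone `f : Set V → ℝ` and ANY nonnegative weight
`ψ : Set V → ℝ` evaluated at the red cluster `R_A(s) = ⋃_{a ∈ A} C_a(s)` of `A`,
  `Σ_{s : A ∩ C_x(s) = ∅} ψ(R_A(s)) · (f(C_x(s)) − f(C_x(sᶜ))) ≤ 0`.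
Conditionally on the red cluster of the avoided set (a disjoint union of cells on each of which `R_A`, hence `ψ`, is frozen), the red cluster of `x` uses only
free edges and is contained in the red cluster of `x` of the pattern-reversed configuration, whose complement is the blue colouring: `cell_sum_le_flip`.
`A = ∅`, `ψ = 1`: `Σ_s (f(C_x s) − f(C_x sᶜ)) = 0`.  `A = {v}`, `ψ = 1`: given `x ↛_red v`, `C_x(red) ≼ C_x(blue)`.  This is the single-function companion of
`offCluster_twoColouring_nonneg` and the tool behind the pendant cases of the coefficientwise van den Berg–Häggström–Kahn family (prim-lf-2 gen 29).
[cite: VandenbergHaggstromKahn2005, Thm. 1.4 p. 5 (context: its coefficientwise form, pendant case below)]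
[cite: KozmaNitzan2024, Questions 8–9 (§5.5 p. 36) (context)] -/
theorem offCluster_domination (ends : ι → Sym2 V) (x : V) (A : Set V) (f : Set V → ℝ) (hf : Monotone f)
    (ψ : Set V → ℝ) (hψ : ∀ S, 0 ≤ ψ S) :
    ∑ s ∈ univ.filter (fun s : Finset ι => ∀ a ∈ A, a ∉ openCluster (ends '' (↑s : Set ι)) x),
      ψ {y | ∃ a ∈ A, y ∈ openCluster (ends '' (↑s : Set ι)) a} *
        (f (openCluster (ends '' (↑s : Set ι)) x) - f (openCluster (ends '' (↑(sᶜ) : Set ι)) x)) ≤ 0 := by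
  -- notation
  set K : Finset ι → Set V := fun s => openCluster (ends '' (↑s : Set ι)) x with hK
  set F : Finset ι → ℝ := fun s => f (K s) with hF
  set R : Finset ι → Set V := fun s => {y | ∃ a ∈ A, y ∈ openCluster (ends '' (↑s : Set ι)) a} with hR
  set D : Finset (Finset ι) := univ.filter (fun s : Finset ι => ∀ a ∈ A, a ∉ openCluster (ends '' (↑s : Set ι)) x) with hD
  change ∑ s ∈ D, ψ (R s) * (F s - F sᶜ) ≤ 0
  have hKmono : ∀ {s t : Finset ι}, s ⊆ t → K s ⊆ K t := fun hst => openCluster_image_mono ends hst x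
  -- the edges at a vertex set, and the cell key
  set I : Set V → Finset ι := fun S => univ.filter (fun i : ι => ∃ v ∈ S, v ∈ ends i) with hI
  set key : Finset ι → Set V × Finset ι := fun s => (R s, s ∩ I (R s)) with hkey
  have R_closed : ∀ (s : Finset ι) {u w : V}, u ∈ R s → (openGraph (ends '' (↑s : Set ι))).Adj u w → w ∈ R s := by
    intro s u w hu hadj
    obtain ⟨a, haA, hau⟩ := hu
    exact ⟨a, haA, SimpleGraph.Reachable.trans hau hadj.reachable⟩
  have mem_I : ∀ (S : Set V) (i : ι) (v : V), v ∈ S → v ∈ ends i → i ∈ I S := by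
    intro S i v hv hvi
    simp only [hI, Finset.mem_filter, Finset.mem_univ, true_and]
    exact ⟨v, hv, hvi⟩
  have A_sub_R : ∀ (s : Finset ι), ∀ a ∈ A, a ∈ R s := fun s a ha => ⟨a, ha, mem_openCluster_self _ a⟩
  -- locality: a configuration agreeing with `s₀` on the edges at `R s₀` has the same red cluster of `A`
  have locality : ∀ s₀ t : Finset ι, t ∩ I (R s₀) = s₀ ∩ I (R s₀) → R t = R s₀ := by
    intro s₀ t ht
    have agree : ∀ i, i ∈ I (R s₀) → (i ∈ t ↔ i ∈ s₀) := by
      intro i hi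
      have := congrArg (fun u : Finset ι => i ∈ u) ht
      simp only [Finset.mem_inter, hi, and_true, eq_iff_iff] at this
      exact this
    have h1 : ∀ u ∈ R s₀, ∀ w, (openGraph (ends '' (↑s₀ : Set ι))).Adj u w →
        (openGraph (ends '' (↑t : Set ι))).Adj u w ∧ w ∈ R s₀ := by
      intro u hu w hadj
      refine ⟨?_, R_closed s₀ hu hadj⟩
      rw [openGraph_image_adj] at hadj ⊢
      obtain ⟨⟨i, his, hi⟩, hne⟩ := hadj
      have hiI : i ∈ I (R s₀) := mem_I _ i u hu (by rw [hi]; exact Sym2.mem_mk_left u w)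
      exact ⟨⟨i, (agree i hiI).mpr his, hi⟩, hne⟩
    have h2 : ∀ u ∈ R s₀, ∀ w, (openGraph (ends '' (↑t : Set ι))).Adj u w →
        (openGraph (ends '' (↑s₀ : Set ι))).Adj u w ∧ w ∈ R s₀ := by
      intro u hu w hadj
      have hadj' : (openGraph (ends '' (↑s₀ : Set ι))).Adj u w := by
        rw [openGraph_image_adj] at hadj ⊢
        obtain ⟨⟨i, hit, hi⟩, hne⟩ := hadj
        have hiI : i ∈ I (R s₀) := mem_I _ i u hu (by rw [hi]; exact Sym2.mem_mk_left u w)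
        exact ⟨⟨i, (agree i hiI).mp hit, hi⟩, hne⟩
      exact ⟨hadj', R_closed s₀ hu hadj'⟩
    ext y
    constructor
    · rintro ⟨a, haA, hay⟩
      obtain ⟨p⟩ := hay
      exact ((reachable_transfer (R s₀) h2 p) (A_sub_R s₀ a haA)).2
    · rintro ⟨a, haA, hay⟩
      obtain ⟨p⟩ := hay
      exact ⟨a, haA, ((reachable_transfer (R s₀) h1 p) (A_sub_R s₀ a haA)).1⟩
  -- split the sum over `D` along the fibres of `key`
  rw [← Finset.sum_fiberwise_of_maps_to (s := D) (t := D.image key) (g := key)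
    (fun s hs => Finset.mem_image_of_mem key hs)]
  refine Finset.sum_nonpos fun k hk => ?_
  obtain ⟨s₀, hs₀D, rfl⟩ := Finset.mem_image.mp hk
  have hs₀ : ∀ a ∈ A, a ∉ K s₀ := by
    have := (Finset.mem_filter.mp hs₀D).2
    simpa [hK] using this
  set S₀ : Set V := R s₀ with hS₀
  set B : Finset ι := I S₀ with hB
  set π : Finset ι := s₀ ∩ B with hπ
  have hxS₀ : x ∉ S₀ := by
    rintro ⟨a, haA, hax⟩
    exact hs₀ a haA (SimpleGraph.Reachable.symm hax)
  -- the fibre of `key s₀` in `D` is exactly the cell `{t | t ∩ B = π}`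
  have fiber_eq : D.filter (fun t => key t = key s₀) = univ.filter (fun t : Finset ι => t ∩ B = π) := by
    ext t
    simp only [Finset.mem_filter, Finset.mem_univ, true_and]
    constructor
    · rintro ⟨_, hkt⟩
      have h1 : R t = S₀ := (Prod.ext_iff.mp hkt).1
      have h2 : t ∩ I (R t) = s₀ ∩ I (R s₀) := (Prod.ext_iff.mp hkt).2
      rw [h1] at h2
      exact h2
    · intro ht
      have hRt : R t = S₀ := locality s₀ t ht
      refine ⟨?_, ?_⟩
      · rw [hD, Finset.mem_filter]
        refine ⟨Finset.mem_univ _, fun a haA hax => ?_⟩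
        have hxRt : x ∈ R t := ⟨a, haA, SimpleGraph.Reachable.symm hax⟩
        rw [hRt] at hxRt
        exact hxS₀ hxRt
      · change (R t, t ∩ I (R t)) = (R s₀, s₀ ∩ I (R s₀))
        rw [hRt]
        exact Prod.ext rfl ht
  rw [fiber_eq]
  -- on the cell the weight is the constant `ψ S₀`
  have hconst : ∀ t : Finset ι, t ∩ B = π → ψ (R t) = ψ S₀ := fun t ht => by rw [locality s₀ t ht]
  have hsum : ∑ t ∈ univ.filter (fun t : Finset ι => t ∩ B = π), ψ (R t) * (F t - F tᶜ) =
      ψ S₀ * (∑ t ∈ univ.filter (fun t : Finset ι => t ∩ B = π), F t - ∑ t ∈ univ.filter (fun t : Finset ι => t ∩ B = π), F tᶜ) := by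
    rw [← Finset.sum_sub_distrib, Finset.mul_sum]
    refine Finset.sum_congr rfl fun t ht => ?_
    rw [hconst t (by simpa using ht)]
  rw [hsum]
  -- on the cell, the red cluster of `x` uses no edge at `S₀`
  have offcluster : ∀ t : Finset ι, t ∩ B = π → K t ⊆ K ((B \ π) ∪ (t \ B)) := by
    intro t ht
    have agree : ∀ i, i ∈ B → (i ∈ t ↔ i ∈ s₀) := by
      intro i hi
      have := congrArg (fun u : Finset ι => i ∈ u) ht
      simp only [hπ, Finset.mem_inter, hi, and_true, eq_iff_iff] at this
      exact this
    have htr : ∀ u ∈ S₀ᶜ, ∀ w, (openGraph (ends '' (↑t : Set ι))).Adj u w →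
        (openGraph (ends '' (↑(t \ B) : Set ι))).Adj u w ∧ w ∈ S₀ᶜ := by
      intro u hu w hadj
      rw [openGraph_image_adj] at hadj
      obtain ⟨⟨i, hit, hi⟩, hne⟩ := hadj
      have hiB : i ∉ B := by
        intro hiB
        have his₀ : i ∈ s₀ := (agree i hiB).mp hit
        have hiB' := hiB
        simp only [hB, hI, Finset.mem_filter, Finset.mem_univ, true_and] at hiB'
        obtain ⟨v, hvS, hvi⟩ := hiB'
        rw [hi, Sym2.mem_iff] at hvi
        rcases hvi with rfl | rfl
        · exact hu hvS
        · have hadj₀ : (openGraph (ends '' (↑s₀ : Set ι))).Adj v u := by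
            rw [openGraph_image_adj]
            exact ⟨⟨i, his₀, by rw [hi, Sym2.eq_swap]⟩, hne.symm⟩
          exact hu (R_closed s₀ hvS hadj₀)
      have hwS : w ∈ S₀ᶜ := by
        intro hwS
        exact hiB (mem_I S₀ i w hwS (by rw [hi]; exact Sym2.mem_mk_right u w))
      refine ⟨?_, hwS⟩
      rw [openGraph_image_adj]
      exact ⟨⟨i, Finset.mem_sdiff.mpr ⟨hit, hiB⟩, hi⟩, hne⟩
    intro y hy
    obtain ⟨p⟩ := hy
    have hreach := ((reachable_transfer S₀ᶜ htr p) hxS₀).1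
    exact hKmono Finset.subset_union_right hreach
  have hle := cell_sum_le_flip B π Finset.inter_subset_right F (fun t ht => hf (offcluster t ht))
  have hψ0 := hψ S₀
  nlinarith [hle, hψ0]

end Coefficientwise

end Summit.CriticalPhenomena.PercolationContinuityZ3.Theorems
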